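import Literature.NumberTheory.LFunctions.MatomakiRadziwillTaoKeyEstimateWith
import Literature.NumberTheory.LFunctions.MatomakiRadziwillTaoPropA3Unconditional
import Literature.NumberTheory.LFunctions.MatomakiRadziwillTaoTheorem13Proofs
import HarnessLib

/-!
# Hardy–Littlewood–Chowla on average (Lichtman–Teräväinen 2022): the typical exponential sum (Prop. 2.1)

Topic `Literature/NumberTheory/Sieve`, companion of `HardyLittlewoodChowla.lean` (the named facts
`lichtmanTeravainen2022_hlc_avg(_liouville)` = J. D. Lichtman, J. Teräväinen, *On the
Hardy–Littlewood–Chowla conjecture on average*, Forum Math. Sigma 10 (2022) e57, arXiv:2111.08912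
[LichtmanTeravainen2022], Theorem 1.2 (i)).  Everything in this file is PROVED; it introduces no
definition and no named fact.

**Proposition 2.1 of the paper** (held copy `paper:arxiv-2111.08912`, §2.1: "Let
`𝒮 = 𝒮_{P₁,Q₁,√X,X}` be as in (2.1) … let `f` be `1`-bounded multiplicative with `M(f; X, W) ≥ 25 log W`.
Then `sup_α ∫₀^X |∑_{x ≤ n ≤ x+H} f(n) 𝟙_𝒮(n) e(nα)| dx ≪ (log H)^{1/3}/P₁^{1/8} · HX`",
deduced there from [MRT2015, Theorem 2.3]) in the discrete `L²` form consumed by Proposition 3.2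
(`HardyLittlewoodChowlaFourier.lean`, hypothesis `hA₂` of `holder_fourier_bound`):

* `LichtmanTeravainen2022.typical_window_sq_sum_le` — from the tree's discrete Theorem 2.3
  (`Literature.NumberTheory.LFunctions.MRT2015.A2With.keyEstimate_typ`, instantiated with the
  restricted-Halász middle term `K (1+M) e^{-M/2}` of `MRT2015.theoremA2With_exp_half`, `κ = 12`):
  for `1`-bounded multiplicative `g`, window length `L = 2H`, height `X' = X + 2H`, a parameter `V`
  in the regime of Theorem 2.3 (`W = V⁵`, `P₁ = W^{200}`, `Q₁ = L/W³`) and `60 log V ≤ M(g; X', V⁵)`,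
  `∑_{k=1}^{X+2H} |∑_{m ∈ (k-2H, k], m ∈ 𝒮} g(m) e(mα)|² ≤ C (2H)² X'/V + (2H)³`
  (the saving is `1/V` rather than the printed `(log H)^{1/3} P₁^{-1/8}`; the passage `L¹ → L²` uses
  the trivial bound `|∑_{window}| ≤ 2H`, and the `2H - 1` truncated windows `k < 2H` contribute
  `≤ (2H)³`).

## References

* J. D. Lichtman, J. Teräväinen, Forum Math. Sigma 10 (2022) e57, arXiv:2111.08912, §2.1,
  Proposition 2.1 and Remark 2.2. [cite: LichtmanTeravainen2022, Proposition 2.1]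
* K. Matomäki, M. Radziwiłł, T. Tao, *An averaged form of Chowla's conjecture*, Algebra & Number
  Theory 9 (2015), Theorem 2.3. [cite: MatomakiRadziwillTao2015, Theorem 2.3]
-/

noncomputable section

open Finset Real
open scoped FourierTransform

namespace Literature.NumberTheory.Sieve.LichtmanTeravainen2022

open Literature.NumberTheory.LFunctions
open Literature.NumberTheory.LFunctions.MRT2015 (typFun norm_typFun_le theoremA2With_exp_half)
open Literature.NumberTheory.LFunctions.MRT2015.A2With (keyEstimate_typ)

/-- A window sum of a `1`-bounded function over `(y, y + s]` has norm `≤ s`. [folklore] -/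
theorem norm_sum_Ioc_le {u : ℕ → ℂ} (hu : ∀ n, ‖u n‖ ≤ 1) (y s : ℕ) (α : ℝ) :
    ‖∑ m ∈ Ioc y (y + s), u m * (𝐞 ((m : ℝ) * α) : ℂ)‖ ≤ s := by
  calc ‖∑ m ∈ Ioc y (y + s), u m * (𝐞 ((m : ℝ) * α) : ℂ)‖
      ≤ ∑ m ∈ Ioc y (y + s), ‖u m * (𝐞 ((m : ℝ) * α) : ℂ)‖ := norm_sum_le _ _
    _ ≤ ∑ _m ∈ Ioc y (y + s), (1 : ℝ) := Finset.sum_le_sum fun m _ => by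
        rw [norm_mul, Circle.norm_coe, mul_one]; exact hu m
    _ = s := by simp

set_option maxHeartbeats 800000 in
/-- **Lichtman–Teräväinen 2022, Proposition 2.1 (discrete `L²` form, from [MRT2015, Thm 2.3]).**
There are absolute `C, V₀, X⁎ > 0` such that for every `1`-bounded multiplicative `g`, all `H ≥ 1`,
`X`, real `V ≥ V₀` and `α`, writing `L = 2H`, `X' = X + 2H`, `W = V⁵`, `𝒮 = 𝒮_{W^{200}, L/W³, √X', X'}`:
if `X' ≥ X⁎`, `W ≤ (log X')^{1/125}`, `V^{1015} ≤ L`, `L V^{75} ≤ X'`, `L ≤ exp(√(log X'/2))`,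
`log L ≤ V` and `60 log V ≤ M(g; X', W)`, then
`∑_{k=1}^{X+2H} |∑_{m ∈ (k-2H, k]} (g 𝟙_𝒮)(m) e(mα)|² ≤ C L² X'/V + L³`.
[cite: LichtmanTeravainen2022, Proposition 2.1] -/
theorem typical_window_sq_sum_le :
    ∃ C V₀ Xs : ℝ, 0 < C ∧ ∀ (X H : ℕ) (V α : ℝ) (g : ArithmeticFunction ℂ),
      g.IsMultiplicative → (∀ n, ‖g n‖ ≤ 1) → 1 ≤ H →
      Xs ≤ ((X + 2 * H : ℕ) : ℝ) → V₀ ≤ V →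
      V ^ 5 ≤ Real.log ((X + 2 * H : ℕ) : ℝ) ^ (1 / 125 : ℝ) →
      V ^ 1015 ≤ ((2 * H : ℕ) : ℝ) → ((2 * H : ℕ) : ℝ) * V ^ 75 ≤ ((X + 2 * H : ℕ) : ℝ) →
      ((2 * H : ℕ) : ℝ) ≤ Real.exp (Real.sqrt (Real.log ((X + 2 * H : ℕ) : ℝ) / 2)) →
      Real.log ((2 * H : ℕ) : ℝ) ≤ V →
      5 * 12 * Real.log V ≤ Sieve.nonpretentiousness g ((X + 2 * H : ℕ) : ℝ) (V ^ 5) →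
      ∑ k ∈ Icc 1 (X + 2 * H), ‖∑ m ∈ Ioc (k - 2 * H) k,
          typFun g ((V ^ 5) ^ 200) (((2 * H : ℕ) : ℝ) / (V ^ 5) ^ 3)
            (Real.sqrt ((X + 2 * H : ℕ) : ℝ)) ((X + 2 * H : ℕ) : ℝ) m * (𝐞 ((m : ℝ) * α) : ℂ)‖ ^ 2 ≤
        C * ((2 * H : ℕ) : ℝ) ^ 2 * ((X + 2 * H : ℕ) : ℝ) / V + ((2 * H : ℕ) : ℝ) ^ 3 := by
  classical
  obtain ⟨K, hK, hA2⟩ := theoremA2With_exp_half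
  obtain ⟨C, V₀, Xs, hC, hkey⟩ := keyEstimate_typ
    (mid := fun M => K * (1 + M) * Real.exp (-M / 2)) (fun M hM => by positivity)
    (fun a b ha hab => Tao2016.mid_exp_half_antitone hK ha hab) hA2 (κ := 12) (by norm_num)
    (Cm := Real.sqrt (12 * K * Real.exp 24)) (W₁ := Real.exp 4) (Real.sqrt_nonneg _)
    (fun W hW => Tao2016.mid_exp_half_decay hK hW)
  refine ⟨C, V₀, Xs, hC, ?_⟩
  intro X H V α g hgm hg1 hH hXs hV₀ hVX hVL hLX hLexp hlogL hM
  set L : ℕ := 2 * H with hL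
  set X' : ℝ := ((X + 2 * H : ℕ) : ℝ) with hX'
  set P₁ : ℝ := (V ^ 5) ^ 200 with hP₁
  set Q₁ : ℝ := (L : ℝ) / (V ^ 5) ^ 3 with hQ₁
  set u : ℕ → ℂ := typFun g P₁ Q₁ (Real.sqrt X') X' with hu
  have hu1 : ∀ n, ‖u n‖ ≤ 1 := fun n => norm_typFun_le hg1 _ _ _ _ n
  have hfloor : ⌊X'⌋₊ = X + 2 * H := by rw [hX', Nat.floor_natCast]
  -- Theorem 2.3 at height `X'`, `X₃ = X'`
  have key := hkey X' X' V L α g hgm hg1 hXs le_rfl (by linarith) hV₀ hVX hVL hLX hLexp hlogL hM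
  rw [hfloor] at key
  -- `e(α m) = e(m α)`
  have key' : ∑ x ∈ range (X + 2 * H + 1), ‖∑ n ∈ Ioc x (x + L), u n * (𝐞 ((n : ℝ) * α) : ℂ)‖ ≤
      C * L * X' / V := by
    refine le_trans (le_of_eq (Finset.sum_congr rfl fun x _ => ?_)) key
    congr 1
    refine Finset.sum_congr rfl fun n _ => ?_
    rw [mul_comm (n : ℝ) α]
  -- split the windows: full ones `k = x + L`, `0 ≤ x ≤ X`, and truncated ones `k < L`
  have hsplit : Icc 1 (X + 2 * H) = Ico 1 L ∪ Icc L (X + L) := by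
    ext k; simp only [Finset.mem_union, Finset.mem_Icc, Finset.mem_Ico, hL]; omega
  have hdisj : Disjoint (Ico 1 L) (Icc L (X + L)) := by
    rw [Finset.disjoint_left]; intro k hk hk'
    simp only [Finset.mem_Ico] at hk; simp only [Finset.mem_Icc] at hk'; omega
  rw [hsplit, Finset.sum_union hdisj]
  -- truncated windows
  have htrunc : ∑ k ∈ Ico 1 L, ‖∑ m ∈ Ioc (k - 2 * H) k, u m * (𝐞 ((m : ℝ) * α) : ℂ)‖ ^ 2 ≤
      (L : ℝ) ^ 3 := by
    have hterm : ∀ k ∈ Ico 1 L, ‖∑ m ∈ Ioc (k - 2 * H) k, u m * (𝐞 ((m : ℝ) * α) : ℂ)‖ ^ 2 ≤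
        (L : ℝ) ^ 2 := by
      intro k hk
      rw [Finset.mem_Ico] at hk
      have hk0 : k - 2 * H = 0 := by omega
      have h1 : ‖∑ m ∈ Ioc (k - 2 * H) k, u m * (𝐞 ((m : ℝ) * α) : ℂ)‖ ≤ k := by
        have := norm_sum_Ioc_le hu1 0 k α
        rwa [zero_add, ← hk0] at this
      have h2 : (k : ℝ) ≤ L := by exact_mod_cast hk.2.le
      have h0 : 0 ≤ ‖∑ m ∈ Ioc (k - 2 * H) k, u m * (𝐞 ((m : ℝ) * α) : ℂ)‖ := norm_nonneg _
      calc _ ≤ (k : ℝ) ^ 2 := pow_le_pow_left₀ h0 h1 2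
        _ ≤ (L : ℝ) ^ 2 := pow_le_pow_left₀ (Nat.cast_nonneg _) h2 2
    calc ∑ k ∈ Ico 1 L, ‖∑ m ∈ Ioc (k - 2 * H) k, u m * (𝐞 ((m : ℝ) * α) : ℂ)‖ ^ 2
        ≤ ∑ _k ∈ Ico 1 L, (L : ℝ) ^ 2 := Finset.sum_le_sum hterm
      _ = ((L - 1 : ℕ) : ℝ) * (L : ℝ) ^ 2 := by rw [Finset.sum_const, Nat.card_Ico, nsmul_eq_mul]
      _ ≤ (L : ℝ) * (L : ℝ) ^ 2 := by
          refine mul_le_mul_of_nonneg_right ?_ (by positivity)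
          exact_mod_cast Nat.sub_le L 1
      _ = (L : ℝ) ^ 3 := by ring
  -- full windows
  have hfull : ∑ k ∈ Icc L (X + L), ‖∑ m ∈ Ioc (k - 2 * H) k, u m * (𝐞 ((m : ℝ) * α) : ℂ)‖ ^ 2 ≤
      C * (L : ℝ) ^ 2 * X' / V := by
    -- reindex `k = x + L`
    have himage : Icc L (X + L) = (Icc 0 X).image (fun x => x + L) := by
      rw [Finset.image_add_right_Icc, zero_add]
    rw [himage, Finset.sum_image fun x _ y _ h => by simpa using h]
    have hIoc : ∀ x : ℕ, Ioc (x + L - 2 * H) (x + L) = Ioc x (x + L) := by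
      intro x; rw [hL, Nat.add_sub_cancel]
    simp_rw [hIoc]
    -- `‖W‖² ≤ L ‖W‖`
    have hsq : ∀ x : ℕ, ‖∑ m ∈ Ioc x (x + L), u m * (𝐞 ((m : ℝ) * α) : ℂ)‖ ^ 2 ≤
        (L : ℝ) * ‖∑ m ∈ Ioc x (x + L), u m * (𝐞 ((m : ℝ) * α) : ℂ)‖ := by
      intro x
      rw [sq]
      exact mul_le_mul_of_nonneg_right (norm_sum_Ioc_le hu1 x L α) (norm_nonneg _)
    calc ∑ x ∈ Icc 0 X, ‖∑ m ∈ Ioc x (x + L), u m * (𝐞 ((m : ℝ) * α) : ℂ)‖ ^ 2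
        ≤ ∑ x ∈ Icc 0 X, (L : ℝ) * ‖∑ m ∈ Ioc x (x + L), u m * (𝐞 ((m : ℝ) * α) : ℂ)‖ :=
          Finset.sum_le_sum fun x _ => hsq x
      _ = (L : ℝ) * ∑ x ∈ Icc 0 X, ‖∑ m ∈ Ioc x (x + L), u m * (𝐞 ((m : ℝ) * α) : ℂ)‖ := by
          rw [Finset.mul_sum]
      _ ≤ (L : ℝ) * ∑ x ∈ range (X + 2 * H + 1), ‖∑ m ∈ Ioc x (x + L), u m * (𝐞 ((m : ℝ) * α) : ℂ)‖ := by
          refine mul_le_mul_of_nonneg_left ?_ (Nat.cast_nonneg _)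
          refine Finset.sum_le_sum_of_subset_of_nonneg (fun x hx => ?_) fun _ _ _ => norm_nonneg _
          rw [Finset.mem_Icc] at hx; rw [Finset.mem_range]; omega
      _ ≤ (L : ℝ) * (C * L * X' / V) := mul_le_mul_of_nonneg_left key' (Nat.cast_nonneg _)
      _ = C * (L : ℝ) ^ 2 * X' / V := by ring
  have hLcast : ((2 * H : ℕ) : ℝ) = (L : ℝ) := by rw [hL]
  rw [hLcast]
  linarith [htrunc, hfull]

end Literature.NumberTheory.Sieve.LichtmanTeravainen2022
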